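import Mathlib.Analysis.Calculus.FDeriv.Prod
import Mathlib.Analysis.Calculus.FDeriv.Mul
import Mathlib.Analysis.Calculus.Deriv.Comp
import Mathlib.Analysis.Calculus.Deriv.Mul
import Mathlib.Analysis.Calculus.FDeriv.Add

/-!
# Planar calculus for the junction profile: derivatives of `(r, t) ↦ t - τ(r)` and
# `(r, t) ↦ c (r - ρ(t))`

Topic `Geometry/Riemannian` (fact seat
`provefact-Literature.Geometry.Riemannian.LawsonMichelsohn1984_surrounding`).  Everything here
is **proved**; no definitions.

The planar profile of the junction of Lawson–Michelsohn's surrounding construction (§3) is glued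
from the graph function `Φ_g(r, t) = t - τ(r)` (zones ii–iii of the bending) and the chimney
function `Φ_c(r, t) = c (r - ρ(t))`; its flat frame sum `Q_k(Φ)`
(`MeanConvexFlatFrameSum.frameSum_biradial`) is a rational expression in the first and second
partial derivatives `Φ_r = DΦ(1,0)`, `Φ_t = DΦ(0,1)`, `Φ_rr = D²Φ(1,0)(1,0)`, … .  This file
computes these Fréchet derivatives on `ℝ × ℝ`:

* `hasFDerivAt_graphProfile`, `fderiv_graphProfile_apply`, `fderiv_fderiv_graphProfile_apply` —
  for `Φ_g`: `DΦ_g(r,t)(a,b) = b - τ'(r) a`, `D²Φ_g(r,t)((a,b),(a',b')) = -τ''(r) a a'`;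
* `hasFDerivAt_chimneyProfile`, `fderiv_chimneyProfile_apply`,
  `fderiv_fderiv_chimneyProfile_apply` — for `Φ_c`: `DΦ_c(r,t)(a,b) = c (a - ρ'(t) b)`,
  `D²Φ_c(r,t)((a,b),(a',b')) = -c ρ''(t) b b'`.

## References

* H. B. Lawson, Jr., M.-L. Michelsohn, *Embedding and surrounding with positive mean curvature*,
  Invent. Math. 77 (1984), §3. [LawsonMichelsohn1984]
-/

noncomputable section

open Set Function Filter
open scoped Topology

namespace Literature.Geometry.Riemannian

/-! ### The graph profile `(r, t) ↦ t - τ(r)` -/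

section Graph

variable (τ : ℝ → ℝ)

/-- `D[(r,t) ↦ t - τ(r)] = snd - τ'(r) • fst`. [folklore] -/
theorem hasFDerivAt_graphProfile {r t τ' : ℝ} (hτ : HasDerivAt τ τ' r) :
    HasFDerivAt (fun p : ℝ × ℝ => p.2 - τ p.1)
      (ContinuousLinearMap.snd ℝ ℝ ℝ - τ' • ContinuousLinearMap.fst ℝ ℝ ℝ) (r, t) := by
  have h1 : HasFDerivAt (fun p : ℝ × ℝ => p.2) (ContinuousLinearMap.snd ℝ ℝ ℝ) (r, t) :=
    hasFDerivAt_snd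
  have h2 : HasFDerivAt (fun p : ℝ × ℝ => τ p.1) (τ' • ContinuousLinearMap.fst ℝ ℝ ℝ) (r, t) :=
    hτ.comp_hasFDerivAt (r, t) hasFDerivAt_fst
  exact h1.sub h2

/-- `D[(r,t) ↦ t - τ(r)](r,t)(a,b) = b - τ'(r) a`. [folklore] -/
theorem fderiv_graphProfile_apply {r t τ' : ℝ} (hτ : HasDerivAt τ τ' r) (a b : ℝ) :
    fderiv ℝ (fun p : ℝ × ℝ => p.2 - τ p.1) (r, t) (a, b) = b - τ' * a := by
  rw [(hasFDerivAt_graphProfile τ hτ).fderiv]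
  simp [smul_eq_mul]

/-- Near a point where `τ` is differentiable, `D[(r,t) ↦ t - τ(r)] = snd - τ'(r) • fst`.
[folklore] -/
theorem fderiv_graphProfile_eventuallyEq {r t : ℝ} (hτ : ∀ᶠ s in 𝓝 r, DifferentiableAt ℝ τ s) :
    (fun p : ℝ × ℝ => fderiv ℝ (fun p : ℝ × ℝ => p.2 - τ p.1) p) =ᶠ[𝓝 (r, t)]
      fun p => ContinuousLinearMap.snd ℝ ℝ ℝ - deriv τ p.1 • ContinuousLinearMap.fst ℝ ℝ ℝ := by
  have h : ∀ᶠ p : ℝ × ℝ in 𝓝 (r, t), DifferentiableAt ℝ τ p.1 :=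
    (continuous_fst.tendsto (r, t)).eventually hτ
  filter_upwards [h] with p hp
  exact (hasFDerivAt_graphProfile τ (r := p.1) (t := p.2) hp.hasDerivAt).fderiv

/-- `D²[(r,t) ↦ t - τ(r)](r,t)((a,b),(a',b')) = -τ''(r) a a'`. [folklore] -/
theorem fderiv_fderiv_graphProfile_apply {r t : ℝ} (hτ : ∀ᶠ s in 𝓝 r, DifferentiableAt ℝ τ s)
    {τ'' : ℝ} (hτ' : HasDerivAt (deriv τ) τ'' r) (a b a' b' : ℝ) :
    fderiv ℝ (fderiv ℝ (fun p : ℝ × ℝ => p.2 - τ p.1)) (r, t) (a, b) (a', b') = -(τ'' * a * a') := by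
  have hd : HasFDerivAt (fun p : ℝ × ℝ =>
      ContinuousLinearMap.snd ℝ ℝ ℝ - deriv τ p.1 • ContinuousLinearMap.fst ℝ ℝ ℝ)
      ((0 : ℝ × ℝ →L[ℝ] ℝ × ℝ →L[ℝ] ℝ) -
        (τ'' • ContinuousLinearMap.fst ℝ ℝ ℝ).smulRight (ContinuousLinearMap.fst ℝ ℝ ℝ)) (r, t) := by
    have h1 : HasFDerivAt (deriv τ ∘ Prod.fst) (τ'' • ContinuousLinearMap.fst ℝ ℝ ℝ) (r, t) :=
      hτ'.comp_hasFDerivAt (r, t) hasFDerivAt_fst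
    exact (hasFDerivAt_const _ _).sub (h1.smul_const (ContinuousLinearMap.fst ℝ ℝ ℝ))
  have hmain := hd.congr_of_eventuallyEq (fderiv_graphProfile_eventuallyEq τ hτ)
  show fderiv ℝ (fun p : ℝ × ℝ => fderiv ℝ (fun p : ℝ × ℝ => p.2 - τ p.1) p) (r, t) (a, b) (a', b') = _
  rw [hmain.fderiv]
  simp [smul_eq_mul, mul_assoc]

end Graph

/-! ### The chimney profile `(r, t) ↦ c (r - ρ(t))` -/

section Chimney

variable (ρ : ℝ → ℝ) (c : ℝ)

/-- `D[(r,t) ↦ c (r - ρ(t))] = c • (fst - ρ'(t) • snd)`. [folklore] -/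
theorem hasFDerivAt_chimneyProfile {r t ρ' : ℝ} (hρ : HasDerivAt ρ ρ' t) :
    HasFDerivAt (fun p : ℝ × ℝ => c * (p.1 - ρ p.2))
      (c • (ContinuousLinearMap.fst ℝ ℝ ℝ - ρ' • ContinuousLinearMap.snd ℝ ℝ ℝ)) (r, t) := by
  have h1 : HasFDerivAt (fun p : ℝ × ℝ => p.1) (ContinuousLinearMap.fst ℝ ℝ ℝ) (r, t) :=
    hasFDerivAt_fst
  have h2 : HasFDerivAt (fun p : ℝ × ℝ => ρ p.2) (ρ' • ContinuousLinearMap.snd ℝ ℝ ℝ) (r, t) :=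
    hρ.comp_hasFDerivAt (r, t) hasFDerivAt_snd
  exact (h1.sub h2).const_smul c

/-- `D[(r,t) ↦ c (r - ρ(t))](r,t)(a,b) = c (a - ρ'(t) b)`. [folklore] -/
theorem fderiv_chimneyProfile_apply {r t ρ' : ℝ} (hρ : HasDerivAt ρ ρ' t) (a b : ℝ) :
    fderiv ℝ (fun p : ℝ × ℝ => c * (p.1 - ρ p.2)) (r, t) (a, b) = c * (a - ρ' * b) := by
  rw [(hasFDerivAt_chimneyProfile ρ c hρ).fderiv]
  simp [smul_eq_mul]

/-- Near a point where `ρ` is differentiable, the differential of the chimney profile.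
[folklore] -/
theorem fderiv_chimneyProfile_eventuallyEq {r t : ℝ} (hρ : ∀ᶠ s in 𝓝 t, DifferentiableAt ℝ ρ s) :
    (fun p : ℝ × ℝ => fderiv ℝ (fun p : ℝ × ℝ => c * (p.1 - ρ p.2)) p) =ᶠ[𝓝 (r, t)]
      fun p => c • (ContinuousLinearMap.fst ℝ ℝ ℝ - deriv ρ p.2 • ContinuousLinearMap.snd ℝ ℝ ℝ) := by
  have h : ∀ᶠ p : ℝ × ℝ in 𝓝 (r, t), DifferentiableAt ℝ ρ p.2 :=
    (continuous_snd.tendsto (r, t)).eventually hρ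
  filter_upwards [h] with p hp
  exact (hasFDerivAt_chimneyProfile ρ c (r := p.1) (t := p.2) hp.hasDerivAt).fderiv

/-- `D²[(r,t) ↦ c (r - ρ(t))](r,t)((a,b),(a',b')) = -c ρ''(t) b b'`. [folklore] -/
theorem fderiv_fderiv_chimneyProfile_apply {r t : ℝ} (hρ : ∀ᶠ s in 𝓝 t, DifferentiableAt ℝ ρ s)
    {ρ'' : ℝ} (hρ' : HasDerivAt (deriv ρ) ρ'' t) (a b a' b' : ℝ) :
    fderiv ℝ (fderiv ℝ (fun p : ℝ × ℝ => c * (p.1 - ρ p.2))) (r, t) (a, b) (a', b') =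
      -(c * ρ'' * b * b') := by
  have hd : HasFDerivAt (fun p : ℝ × ℝ =>
      c • (ContinuousLinearMap.fst ℝ ℝ ℝ - deriv ρ p.2 • ContinuousLinearMap.snd ℝ ℝ ℝ))
      (c • ((0 : ℝ × ℝ →L[ℝ] ℝ × ℝ →L[ℝ] ℝ) -
        (ρ'' • ContinuousLinearMap.snd ℝ ℝ ℝ).smulRight (ContinuousLinearMap.snd ℝ ℝ ℝ))) (r, t) := by
    have h1 : HasFDerivAt (deriv ρ ∘ Prod.snd) (ρ'' • ContinuousLinearMap.snd ℝ ℝ ℝ) (r, t) :=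
      hρ'.comp_hasFDerivAt (r, t) hasFDerivAt_snd
    exact ((hasFDerivAt_const _ _).sub (h1.smul_const (ContinuousLinearMap.snd ℝ ℝ ℝ))).const_smul c
  have hmain := hd.congr_of_eventuallyEq (fderiv_chimneyProfile_eventuallyEq ρ c hρ)
  show fderiv ℝ (fun p : ℝ × ℝ => fderiv ℝ (fun p : ℝ × ℝ => c * (p.1 - ρ p.2)) p) (r, t) (a, b) (a', b') = _
  rw [hmain.fderiv]
  simp [smul_eq_mul]
  ring

end Chimney

end Literature.Geometry.Riemannian

end
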